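import Literature.NumberTheory.Rogawski1990.ArchInnerTransferHaarForm            -- ★ A-p14 p842421 N4 FILE A: `finsum_integral_comp_conj_eq_finsum_integral_comp_conj_of_isArchInnerTransfer`
import Literature.NumberTheory.Rogawski1990.ArchHaarTorusReading                  -- ★ p02 p842413 N3-b: `corresponds_archDiagTorus_archCongr_symm_archDiagTorus`, `isRegularElt_coe_archCongr_symm_iff`
import Literature.NumberTheory.Automorphic.ArchStableOrbitalSumRepresentatives   -- ★ `isCompact_centralizer_archDiagTorus`; brings ★ (V8) `exists_isConj_archDiagTorus_of_isStablyConj_of_conj`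
import Literature.NumberTheory.Rogawski1990.ArchEndoscopicStableClassCompactH     -- ★ `isCompact_centralizer_of_isCompact_centralizer_archCongr`
import Literature.NumberTheory.Rogawski1990.ArchEndoscopicCurveRegularCompact     -- ★ `isCompact_centralizer_singleton_of_isConj`
import Literature.NumberTheory.Rogawski1990.ArchSmoothCongruence                 -- ★ `coe_archCongr_symm_apply`
import HarnessLib

/-!
# (14.2.1) at `∞` in HAAR currency AT THE REGULAR TORUS POINTS `(t_α(z), Ψ⁻¹ t_γ(z))`, compactness discharged, plus the class-weighted reading
# (Rogawski 1990 §14.2 (14.2.1), §1.7; SdArch ED. 3 node N4 «E1-inner», FILE B = the torus reading over ★ FILE A)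

Topic `NumberTheory/Rogawski1990`; namespaces `Literature.NumberTheory.Automorphic.UnitaryGroup` (§1, generic `N`) and `Literature.NumberTheory.Rogawski1990` (§2–§3).  THEOREMS ONLY
(no `def`, no instance, no notation, no axiom, no named fact, no `sorry`).  Cell `pub/hodgecm-mathlib`, ENGINE T1 (crux H413 = `stmt-HodgeConjecture-24833`); ROAD-Sd, line
`Cruxes/H413/Lines/F0_P3a_SdArch.lean` ED. 3 design (p03 (g11) 7141d221 §1 (D3), node N4); pen N4 A-p14 (g28) (FILE A ★ p842421), co-hand A-p13 (g31) (this file).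

WHAT IS PROVED.
§1 (generic `N`, diagonal carrier `U(diag α)_∞` and a congruence frame `Φ : U(H₂)_∞ ≃ₜ* U(diag γ)_∞`, `g ↦ T g T⁻¹`, N3-b convention): every element stably conjugate to a REGULAR torus
   point has a COMPACT centraliser — `compactSpace_centralizer_of_isStablyConj_archDiagTorus` (★ `exists_isConj_archDiagTorus_of_isStablyConj_of_conj` ∘ ★
   `isCompact_centralizer_archDiagTorus` ∘ ★ `isCompact_centralizer_singleton_of_isConj`) and, through the frame, `compactSpace_centralizer_of_isStablyConj_archCongr_symm_archDiagTorus`.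
§2 (`N = 3`, FILE A's frame `(L, H′ := diagonal α, t′, t, hd′, hd₃, (C), (C′G))` + the quasi-split-side frame `(γ, T, Φ, hΦ)`): **`finsum_integral_comp_conj_archDiagTorus_eq_of_isArchInnerTransfer`**
   — ★ FILE A at `(γ_G, γ′) := (Φ⁻¹ t_γ(z), t_α(z))` for `z` with pairwise distinct angles at every place: regularity ★ `isRegularElt_coe_archCongr_symm_iff` ∘ ★ `isRegularElt_archDiagTorus_iff`,
   the correspondence ★ `corresponds_archDiagTorus_archCongr_symm_archDiagTorus`, the two compact-centraliser binders DISCHARGED by §1 — so NO compactness hypothesis is left: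
   `∑ᶠ c′ ∈ {c′ | t_α(z) ∼st out c′}, ∫_{G′_∞} a′(g·out c′·g⁻¹) dν′ = ∑ᶠ c ∈ {c | Φ⁻¹ t_γ(z) ∼st out c}, ∫_{G_∞} a(x·out c·x⁻¹) dν`.
§3 the CLASS-WEIGHTED reading (generic weight `w : ConjClasses G_∞ → ℂ`; Kottwitz's `E_∞` of ★ `kottwitzSignArchWeight` is one instance, not imported here):
   `integral_comp_conj_classWeight_mul` (`w` pulls out of the Haar conjugation integral) and **`finsum_integral_comp_conj_archDiagTorus_eq_finsum_classWeight_mul_of_isArchInnerTransfer`**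
   (§2 for the pair `(a′, x ↦ w⟦x⟧·ã x)`: the `G`-side reads `∑ᶠ c, w c · ∫ ã(x·out c·x⁻¹) dν`) — where the descent (N5) wants signs, they enter through the pair (v) delivers, not through (14.2.1).
HONEST LABEL: HC_CM is proved only modulo the 2 remaining named inputs (hLiu418, h413) until rung 0 closes; this file is measure bookkeeping inside the letter's system and pays nothing by itself.

## References
* [Rogawski1990] J. D. Rogawski, *Automorphic Representations of Unitary Groups in Three Variables*, Ann. of Math. Stud. 123 (1990), §14.2 (14.2.1) p. 232; §1.7 p. 6; §3.1 p. 19; §8.2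
  Prop. 8.2.1 p. 118; §4.1 (4.1.2) p. 39.
* [PlatonovRapinchuk1994] V. Platonov, A. Rapinchuk, *Algebraic Groups and Number Theory* (1994), §2.3 (congruent forms), §3.2 Thm. 3.1.
-/

set_option autoImplicit false

noncomputable section

open MeasureTheory Measure NumberField NumberField.InfinitePlace
open Literature.MeasureTheory.Group

/-! ## §1 Compact centralisers along the stable class of a regular torus point (generic `N`) -/

namespace Literature.NumberTheory.Automorphic.UnitaryGroup

section Compact

variable (L : Type) [Field L] [NumberField L] [IsCMField L] (N : ℕ) (α γ : Fin N → L) {H₂ : Matrix (Fin N) (Fin N) L}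
  (T : GL (Fin N) (mixedEmbedding.mixedSpace L)) (Φ : (arch (↥(maximalRealSubfield L)) L (IsCMField.complexConj L) N H₂) ≃ₜ* (arch (↥(maximalRealSubfield L)) L (IsCMField.complexConj L) N (Matrix.diagonal γ)))
  (hΦ : ∀ g : (arch (↥(maximalRealSubfield L)) L (IsCMField.complexConj L) N H₂), ((Φ g : (arch (↥(maximalRealSubfield L)) L (IsCMField.complexConj L) N (Matrix.diagonal γ))) : GL (Fin N) (mixedEmbedding.mixedSpace L)) = T * (g : GL (Fin N) (mixedEmbedding.mixedSpace L)) * T⁻¹)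

/-- **Every element of `U(diag α)_∞` stably conjugate to a regular torus point has a COMPACT centraliser**: it is conjugate to a relabelled regular torus point
(★ `exists_isConj_archDiagTorus_of_isStablyConj_of_conj`), whose centraliser is the compact torus (★ `isCompact_centralizer_archDiagTorus`).
[cite: Rogawski1990, §3.1 p. 19; §8.2 Prop. 8.2.1 p. 118] -/
theorem compactSpace_centralizer_of_isStablyConj_archDiagTorus (hα : ∀ i, α i ≠ 0) (hherm : ∀ i, (IsCMField.complexConj L (α i) : L) = α i)
    {z : {w : InfinitePlace L // IsComplex w} → Fin N → Circle} (hz : ∀ w, Function.Injective (z w)) (a : (arch (↥(maximalRealSubfield L)) L (IsCMField.complexConj L) N (Matrix.diagonal α)))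
    (ha : Literature.NumberTheory.Rogawski1990.IsStablyConj (conjMixed (↥(maximalRealSubfield L)) L (IsCMField.complexConj L)) (archFormOf L N (Matrix.diagonal α))
      (archDiagTorus L N α z) a) :
    CompactSpace (Subgroup.centralizer ({a} : Set (arch (↥(maximalRealSubfield L)) L (IsCMField.complexConj L) N (Matrix.diagonal α)))) := by
  obtain ⟨ρ, hρ⟩ := exists_isConj_archDiagTorus_of_isStablyConj_of_conj L N α hα hherm z a ha
  exact isCompact_iff_compactSpace.1 (Literature.NumberTheory.Rogawski1990.isCompact_centralizer_singleton_of_isConj hρ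
    (isCompact_centralizer_archDiagTorus L N α hα fun w => (hz w).comp (ρ w).injective))

include hΦ in
/-- **Through a frame** `Φ : U(H₂)_∞ ≃ₜ* U(diag γ)_∞`: every `a ∈ U(H₂)_∞` stably conjugate to `Φ⁻¹ t_γ(z)`, `z` regular, has a COMPACT centraliser (`Z(a) = Φ⁻¹ Z(Φ a)`,
★ `isCompact_centralizer_of_isCompact_centralizer_archCongr`; stable conjugacy is carried by `Φ`, ★ `isStablyConj_archCongr_iff`).
[cite: Rogawski1990, §3.1 p. 19; §14.1 p. 232] [cite: PlatonovRapinchuk1994, §2.3] -/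
theorem compactSpace_centralizer_of_isStablyConj_archCongr_symm_archDiagTorus (hγ : ∀ i, γ i ≠ 0) (hhermγ : ∀ i, (IsCMField.complexConj L (γ i) : L) = γ i)
    {z : {w : InfinitePlace L // IsComplex w} → Fin N → Circle} (hz : ∀ w, Function.Injective (z w)) (a : (arch (↥(maximalRealSubfield L)) L (IsCMField.complexConj L) N H₂))
    (ha : Literature.NumberTheory.Rogawski1990.IsStablyConj (conjMixed (↥(maximalRealSubfield L)) L (IsCMField.complexConj L)) (archFormOf L N H₂)
      (Φ.symm (archDiagTorus L N γ z)) a) :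
    CompactSpace (Subgroup.centralizer ({a} : Set (arch (↥(maximalRealSubfield L)) L (IsCMField.complexConj L) N H₂))) := by
  have ha' : Literature.NumberTheory.Rogawski1990.IsStablyConj (conjMixed (↥(maximalRealSubfield L)) L (IsCMField.complexConj L)) (archFormOf L N (Matrix.diagonal γ))
      (archDiagTorus L N γ z) (Φ a) := by
    have h := (Literature.NumberTheory.Rogawski1990.isStablyConj_archCongr_iff L T Φ hΦ (Φ.symm (archDiagTorus L N γ z)) a).2 ha
    rwa [ContinuousMulEquiv.apply_symm_apply] at h
  haveI : CompactSpace (Subgroup.centralizer ({Φ a} : Set (arch (↥(maximalRealSubfield L)) L (IsCMField.complexConj L) N (Matrix.diagonal γ)))) := compactSpace_centralizer_of_isStablyConj_archDiagTorus L N γ hγ hhermγ hz (Φ a) ha'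
  refine isCompact_iff_compactSpace.1 (Literature.NumberTheory.Rogawski1990.isCompact_centralizer_of_isCompact_centralizer_archCongr L Φ a ?_)
  exact isCompact_iff_compactSpace.2 inferInstance

end Compact

end Literature.NumberTheory.Automorphic.UnitaryGroup

namespace Literature.NumberTheory.Rogawski1990

open Literature.NumberTheory.Automorphic Literature.NumberTheory.Automorphic.UnitaryGroup

/-! ## §2 (14.2.1) in Haar currency at the regular torus points -/

section Torus

variable (L : Type) [Field L] [NumberField L] [IsCMField L] (α : Fin 3 → L)
  [MeasurableSpace (UnitaryGroup.arch (↥(maximalRealSubfield L)) L (IsCMField.complexConj L) 3 (Matrix.diagonal α))] [BorelSpace (UnitaryGroup.arch (↥(maximalRealSubfield L)) L (IsCMField.complexConj L) 3 (Matrix.diagonal α))] [MeasurableSpace (UnitaryGroup.arch (↥(maximalRealSubfield L)) L (IsCMField.complexConj L) 3 (Matrix.of fun i j : Fin 3 => if i.val + j.val + 1 = 3 then (1 : L) else 0))] [BorelSpace (UnitaryGroup.arch (↥(maximalRealSubfield L)) L (IsCMField.complexConj L) 3 (Matrix.of fun i j : Fin 3 => if i.val + j.val + 1 = 3 then (1 :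 L) else 0))]
  (t' : ∀ γ' : (UnitaryGroup.arch (↥(maximalRealSubfield L)) L (IsCMField.complexConj L) 3 (Matrix.diagonal α)), Measure (Subgroup.centralizer ({γ'} : Set (UnitaryGroup.arch (↥(maximalRealSubfield L)) L (IsCMField.complexConj L) 3 (Matrix.diagonal α)))))
  (t : ∀ γ₀ : (UnitaryGroup.arch (↥(maximalRealSubfield L)) L (IsCMField.complexConj L) 3 (Matrix.of fun i j : Fin 3 => if i.val + j.val + 1 = 3 then (1 : L) else 0)), Measure (Subgroup.centralizer ({γ₀} : Set (UnitaryGroup.arch (↥(maximalRealSubfield L)) L (IsCMField.complexConj L) 3 (Matrix.of fun i j : Fin 3 => if i.val + j.val + 1 = 3 then (1 : L) else 0)))))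
  (hd' : (Matrix.diagonal α).det ≠ 0) (hd₃ : (Matrix.of fun i j : Fin 3 => if i.val + j.val + 1 = 3 then (1 : L) else 0).det ≠ 0)
  -- (C): stable invariance of `t` on the quasi-split `G_∞` (FILE A's binder VERBATIM)
  (hC : ∀ (γ₁ γ₂ : (UnitaryGroup.arch (↥(maximalRealSubfield L)) L (IsCMField.complexConj L) 3 (Matrix.of fun i j : Fin 3 => if i.val + j.val + 1 = 3 then (1 : L) else 0))) (h₁ : IsRegularElt (γ₁.val : GL (Fin 3) (mixedEmbedding.mixedSpace L))) (hc : Corresponds (UnitaryGroup.conjMixed (↥(maximalRealSubfield L)) L (IsCMField.complexConj L)) (UnitaryGroup.archFormOf L 3 (Matrix.of fun i j : Fin 3 => if i.val + j.val + 1 = 3 then (1 : L) else 0)) (UnitaryGroup.archFormOf L 3 (Matrix.of fun i j : Fin 3 => if i.val + j.val + 1 = 3 then (1 : L) else 0)) γ₁ γ₂),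
      Measure.map ⇑(UnitaryGroup.archStableCentralizerEquiv L hd₃ hd₃ hc h₁) (t γ₁) = t γ₂)
  -- (C′G): `t′ ↔ t` across the inner twist (FILE A's binder VERBATIM at `H′ := diagonal α`)
  (hC'G : ∀ (γ' : (UnitaryGroup.arch (↥(maximalRealSubfield L)) L (IsCMField.complexConj L) 3 (Matrix.diagonal α))) (γ₀ : (UnitaryGroup.arch (↥(maximalRealSubfield L)) L (IsCMField.complexConj L) 3 (Matrix.of fun i j : Fin 3 => if i.val + j.val + 1 = 3 then (1 : L) else 0))) (h' : IsRegularElt (γ'.val : GL (Fin 3) (mixedEmbedding.mixedSpace L))) (hc : Corresponds (UnitaryGroup.conjMixed (↥(maximalRealSubfield L)) L (IsCMField.complexConj L)) (UnitaryGroup.archFormOf L 3 (Matrix.diagonal α)) (UnitaryGroup.archFormOf L 3 (Matrix.of fun i j : Fin 3 => if i.val + j.val + 1 = 3 then (1 : L) else 0)) γ' γ₀),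
      Measure.map ⇑(UnitaryGroup.archStableCentralizerEquiv L hd' hd₃ hc h') (t' γ') = t γ₀)
  -- the quasi-split-side frame (N3-b convention): `Φ : U(Φ₃)_∞ ≃ₜ* U(diag γ)_∞`, `g ↦ T g T⁻¹` (e.g. `Ψ_Q`, ★ `coe_archCongrOfEq_quasiSplit_apply`)
  (γ : Fin 3 → L) (T : GL (Fin 3) (mixedEmbedding.mixedSpace L)) (Φ : (UnitaryGroup.arch (↥(maximalRealSubfield L)) L (IsCMField.complexConj L) 3 (Matrix.of fun i j : Fin 3 => if i.val + j.val + 1 = 3 then (1 : L) else 0)) ≃ₜ* (UnitaryGroup.arch (↥(maximalRealSubfield L)) L (IsCMField.complexConj L) 3 (Matrix.diagonal γ)))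
  (hΦ : ∀ g : (UnitaryGroup.arch (↥(maximalRealSubfield L)) L (IsCMField.complexConj L) 3 (Matrix.of fun i j : Fin 3 => if i.val + j.val + 1 = 3 then (1 : L) else 0)), ((Φ g : (UnitaryGroup.arch (↥(maximalRealSubfield L)) L (IsCMField.complexConj L) 3 (Matrix.diagonal γ))) : GL (Fin 3) (mixedEmbedding.mixedSpace L)) = T * (g : GL (Fin 3) (mixedEmbedding.mixedSpace L)) * T⁻¹)
  [∀ γ' : (UnitaryGroup.arch (↥(maximalRealSubfield L)) L (IsCMField.complexConj L) 3 (Matrix.diagonal α)), MeasurableSpace ((UnitaryGroup.arch (↥(maximalRealSubfield L)) L (IsCMField.complexConj L) 3 (Matrix.diagonal α)) ⧸ Subgroup.centralizer ({γ'} : Set (UnitaryGroup.arch (↥(maximalRealSubfield L)) L (IsCMField.complexConj L) 3 (Matrix.diagonal α))))]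
  [∀ γ' : (UnitaryGroup.arch (↥(maximalRealSubfield L)) L (IsCMField.complexConj L) 3 (Matrix.diagonal α)), BorelSpace ((UnitaryGroup.arch (↥(maximalRealSubfield L)) L (IsCMField.complexConj L) 3 (Matrix.diagonal α)) ⧸ Subgroup.centralizer ({γ'} : Set (UnitaryGroup.arch (↥(maximalRealSubfield L)) L (IsCMField.complexConj L) 3 (Matrix.diagonal α))))]
  [∀ γ₀ : (UnitaryGroup.arch (↥(maximalRealSubfield L)) L (IsCMField.complexConj L) 3 (Matrix.of fun i j : Fin 3 => if i.val + j.val + 1 = 3 then (1 : L) else 0)), MeasurableSpace ((UnitaryGroup.arch (↥(maximalRealSubfield L)) L (IsCMField.complexConj L) 3 (Matrix.of fun i j : Fin 3 => if i.val + j.val + 1 = 3 then (1 : L) else 0)) ⧸ Subgroup.centralizer ({γ₀} : Set (UnitaryGroup.arch (↥(maximalRealSubfield L)) L (IsCMField.complexConj L) 3 (Matrix.of fun i j : Fin 3 => if i.val + j.val + 1 = 3 then (1 : L) else 0))))]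
  [∀ γ₀ : (UnitaryGroup.arch (↥(maximalRealSubfield L)) L (IsCMField.complexConj L) 3 (Matrix.of fun i j : Fin 3 => if i.val + j.val + 1 = 3 then (1 : L) else 0)), BorelSpace ((UnitaryGroup.arch (↥(maximalRealSubfield L)) L (IsCMField.complexConj L) 3 (Matrix.of fun i j : Fin 3 => if i.val + j.val + 1 = 3 then (1 : L) else 0)) ⧸ Subgroup.centralizer ({γ₀} : Set (UnitaryGroup.arch (↥(maximalRealSubfield L)) L (IsCMField.complexConj L) 3 (Matrix.of fun i j : Fin 3 => if i.val + j.val + 1 = 3 then (1 : L) else 0))))]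

include hC hC'G hΦ in
/-- **(14.2.1) IN HAAR CURRENCY AT THE REGULAR TORUS POINTS** — ★ FILE A `finsum_integral_comp_conj_eq_finsum_integral_comp_conj_of_isArchInnerTransfer` at the matched regular pair
`(Φ⁻¹ t_γ(z), t_α(z))` (★ `corresponds_archDiagTorus_archCongr_symm_archDiagTorus`), `z` with pairwise distinct angles at every place (★ `isRegularElt_archDiagTorus_iff` through ★
`isRegularElt_coe_archCongr_symm_iff`), the two compact-centraliser binders discharged by §1:
`∑ᶠ c′ ∈ {c′ | t_α(z) ∼st out c′}, ∫_{G′_∞} a′(g·out c′·g⁻¹) dν′ = ∑ᶠ c ∈ {c | Φ⁻¹ t_γ(z) ∼st out c}, ∫_{G_∞} a(x·out c·x⁻¹) dν` — the (D3) input of the rank-2 descent (N5), whose two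
sides N3-c (`…_eq_sum_perm`) and N3-b (★ `exists_integral_comp_conj_archCongr_symm_eq_mul_integral_pi`) then read as labelled sums of product integrals.
[cite: Rogawski1990, §14.2 (14.2.1) p. 232; §1.7 p. 6; §8.2 Prop. 8.2.1 p. 118] -/
theorem finsum_integral_comp_conj_archDiagTorus_eq_of_isArchInnerTransfer
    (hα : ∀ i, α i ≠ 0) (hhermα : ∀ i, (IsCMField.complexConj L (α i) : L) = α i) (hγ : ∀ i, γ i ≠ 0) (hhermγ : ∀ i, (IsCMField.complexConj L (γ i) : L) = γ i)
    (ν' : Measure (UnitaryGroup.arch (↥(maximalRealSubfield L)) L (IsCMField.complexConj L) 3 (Matrix.diagonal α))) (ν : Measure (UnitaryGroup.arch (↥(maximalRealSubfield L)) L (IsCMField.complexConj L) 3 (Matrix.of fun i j : Fin 3 => if i.val + j.val + 1 = 3 then (1 : L) else 0))) [ν'.IsHaarMeasure] [ν'.IsMulRightInvariant] [ν.IsHaarMeasure] [ν.IsMulRightInvariant]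
    (m' : OrbitalMeasureFamily (UnitaryGroup.arch (↥(maximalRealSubfield L)) L (IsCMField.complexConj L) 3 (Matrix.diagonal α))) (m : OrbitalMeasureFamily (UnitaryGroup.arch (↥(maximalRealSubfield L)) L (IsCMField.complexConj L) 3 (Matrix.of fun i j : Fin 3 => if i.val + j.val + 1 = 3 then (1 : L) else 0)))
    (hW' : m'.IsQuotientOf (fun γ₀ => IsRegularElt (γ₀.val : GL (Fin 3) (mixedEmbedding.mixedSpace L))) ν' t')
    (hW : m.IsQuotientOf (fun γ₀ => IsRegularElt (γ₀.val : GL (Fin 3) (mixedEmbedding.mixedSpace L))) ν t)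
    (a' : (UnitaryGroup.arch (↥(maximalRealSubfield L)) L (IsCMField.complexConj L) 3 (Matrix.diagonal α)) → ℂ) (a : (UnitaryGroup.arch (↥(maximalRealSubfield L)) L (IsCMField.complexConj L) 3 (Matrix.of fun i j : Fin 3 => if i.val + j.val + 1 = 3 then (1 : L) else 0)) → ℂ) (ha' : Measurable a') (ha : Measurable a) (hit : IsArchInnerTransfer L (Matrix.diagonal α) m' m a' a)
    (z : {w : InfinitePlace L // IsComplex w} → Fin 3 → Circle) (hz : ∀ w, Function.Injective (z w)) :
    ∑ᶠ c' ∈ {c' : ConjClasses (UnitaryGroup.arch (↥(maximalRealSubfield L)) L (IsCMField.complexConj L) 3 (Matrix.diagonal α)) | IsStablyConj (UnitaryGroup.conjMixed (↥(maximalRealSubfield L)) L (IsCMField.complexConj L)) (UnitaryGroup.archFormOf L 3 (Matrix.diagonal α)) (archDiagTorus L 3 α z) (Quotient.out c')}, ∫ g, a' (g * Quotient.out c' * g⁻¹) ∂ν' =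
      ∑ᶠ c ∈ {c : ConjClasses (UnitaryGroup.arch (↥(maximalRealSubfield L)) L (IsCMField.complexConj L) 3 (Matrix.of fun i j : Fin 3 => if i.val + j.val + 1 = 3 then (1 : L) else 0)) | IsStablyConj (UnitaryGroup.conjMixed (↥(maximalRealSubfield L)) L (IsCMField.complexConj L)) (UnitaryGroup.archFormOf L 3 (Matrix.of fun i j : Fin 3 => if i.val + j.val + 1 = 3 then (1 : L) else 0)) (Φ.symm (archDiagTorus L 3 γ z)) (Quotient.out c)}, ∫ x, a (x * Quotient.out c * x⁻¹) ∂ν :=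
  finsum_integral_comp_conj_eq_finsum_integral_comp_conj_of_isArchInnerTransfer L (Matrix.diagonal α) t' t hd' hd₃ hC hC'G ν' ν m' m hW' hW a' a ha' ha hit
    (Φ.symm (archDiagTorus L 3 γ z)) ((isRegularElt_coe_archCongr_symm_iff L γ T Φ hΦ _).2 ((isRegularElt_archDiagTorus_iff L 3 γ z).2 hz))
    (archDiagTorus L 3 α z) (corresponds_archDiagTorus_archCongr_symm_archDiagTorus L γ T Φ hΦ α z)
    (fun δ hδ => compactSpace_centralizer_of_isStablyConj_archCongr_symm_archDiagTorus L 3 γ T Φ hΦ hγ hhermγ hz δ hδ)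
    (fun δ' hδ' => compactSpace_centralizer_of_isStablyConj_archDiagTorus L 3 α hα hhermα hz δ' hδ')

end Torus

/-! ## §3 The class-weighted reading -/

section Weighted

variable {G : Type*} [Group G] [MeasurableSpace G]

/-- **A class weight pulls out of the Haar conjugation integral**: `∫ w⟦x·γ·x⁻¹⟧ · f(x·γ·x⁻¹) dν(x) = w⟦γ⟧ · ∫ f(x·γ·x⁻¹) dν(x)` (`⟦x γ x⁻¹⟧ = ⟦γ⟧`).
[cite: Rogawski1990, §4.1 (4.1.2) p. 39] -/
theorem integral_comp_conj_classWeight_mul (ν : Measure G) (w : ConjClasses G → ℂ) (f : G → ℂ) (γ₀ : G) :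
    ∫ x, w (ConjClasses.mk (x * γ₀ * x⁻¹)) * f (x * γ₀ * x⁻¹) ∂ν = w (ConjClasses.mk γ₀) * ∫ x, f (x * γ₀ * x⁻¹) ∂ν := by
  have hw : ∀ x : G, w (ConjClasses.mk (x * γ₀ * x⁻¹)) = w (ConjClasses.mk γ₀) := fun x =>
    congrArg w (ConjClasses.mk_eq_mk_iff_isConj.2 (isConj_iff.2 ⟨x, rfl⟩)).symm
  simp_rw [hw]
  exact integral_const_mul _ _

end Weighted

section TorusWeighted

variable (L : Type) [Field L] [NumberField L] [IsCMField L] (α : Fin 3 → L)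
  [MeasurableSpace (UnitaryGroup.arch (↥(maximalRealSubfield L)) L (IsCMField.complexConj L) 3 (Matrix.diagonal α))] [BorelSpace (UnitaryGroup.arch (↥(maximalRealSubfield L)) L (IsCMField.complexConj L) 3 (Matrix.diagonal α))] [MeasurableSpace (UnitaryGroup.arch (↥(maximalRealSubfield L)) L (IsCMField.complexConj L) 3 (Matrix.of fun i j : Fin 3 => if i.val + j.val + 1 = 3 then (1 : L) else 0))] [BorelSpace (UnitaryGroup.arch (↥(maximalRealSubfield L)) L (IsCMField.complexConj L) 3 (Matrix.of fun i j : Fin 3 => if i.val + j.val + 1 = 3 then (1 : L) else 0))]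
  (t' : ∀ γ' : (UnitaryGroup.arch (↥(maximalRealSubfield L)) L (IsCMField.complexConj L) 3 (Matrix.diagonal α)), Measure (Subgroup.centralizer ({γ'} : Set (UnitaryGroup.arch (↥(maximalRealSubfield L)) L (IsCMField.complexConj L) 3 (Matrix.diagonal α)))))
  (t : ∀ γ₀ : (UnitaryGroup.arch (↥(maximalRealSubfield L)) L (IsCMField.complexConj L) 3 (Matrix.of fun i j : Fin 3 => if i.val + j.val + 1 = 3 then (1 : L) else 0)), Measure (Subgroup.centralizer ({γ₀} : Set (UnitaryGroup.arch (↥(maximalRealSubfield L)) L (IsCMField.complexConj L) 3 (Matrix.of fun i j : Fin 3 => if i.val + j.val + 1 = 3 then (1 : L) else 0)))))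
  (hd' : (Matrix.diagonal α).det ≠ 0) (hd₃ : (Matrix.of fun i j : Fin 3 => if i.val + j.val + 1 = 3 then (1 : L) else 0).det ≠ 0)
  (hC : ∀ (γ₁ γ₂ : (UnitaryGroup.arch (↥(maximalRealSubfield L)) L (IsCMField.complexConj L) 3 (Matrix.of fun i j : Fin 3 => if i.val + j.val + 1 = 3 then (1 : L) else 0))) (h₁ : IsRegularElt (γ₁.val : GL (Fin 3) (mixedEmbedding.mixedSpace L))) (hc : Corresponds (UnitaryGroup.conjMixed (↥(maximalRealSubfield L)) L (IsCMField.complexConj L)) (UnitaryGroup.archFormOf L 3 (Matrix.of fun i j : Fin 3 => if i.val + j.val + 1 = 3 then (1 : L) else 0)) (UnitaryGroup.archFormOf L 3 (Matrix.of fun i j : Fin 3 => if i.val + j.val + 1 = 3 then (1 : L) else 0)) γ₁ γ₂),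
      Measure.map ⇑(UnitaryGroup.archStableCentralizerEquiv L hd₃ hd₃ hc h₁) (t γ₁) = t γ₂)
  (hC'G : ∀ (γ' : (UnitaryGroup.arch (↥(maximalRealSubfield L)) L (IsCMField.complexConj L) 3 (Matrix.diagonal α))) (γ₀ : (UnitaryGroup.arch (↥(maximalRealSubfield L)) L (IsCMField.complexConj L) 3 (Matrix.of fun i j : Fin 3 => if i.val + j.val + 1 = 3 then (1 : L) else 0))) (h' : IsRegularElt (γ'.val : GL (Fin 3) (mixedEmbedding.mixedSpace L))) (hc : Corresponds (UnitaryGroup.conjMixed (↥(maximalRealSubfield L)) L (IsCMField.complexConj L)) (UnitaryGroup.archFormOf L 3 (Matrix.diagonal α)) (UnitaryGroup.archFormOf L 3 (Matrix.of fun i j : Fin 3 => if i.val + j.val + 1 = 3 then (1 : L) else 0)) γ' γ₀),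
      Measure.map ⇑(UnitaryGroup.archStableCentralizerEquiv L hd' hd₃ hc h') (t' γ') = t γ₀)
  (γ : Fin 3 → L) (T : GL (Fin 3) (mixedEmbedding.mixedSpace L)) (Φ : (UnitaryGroup.arch (↥(maximalRealSubfield L)) L (IsCMField.complexConj L) 3 (Matrix.of fun i j : Fin 3 => if i.val + j.val + 1 = 3 then (1 : L) else 0)) ≃ₜ* (UnitaryGroup.arch (↥(maximalRealSubfield L)) L (IsCMField.complexConj L) 3 (Matrix.diagonal γ)))
  (hΦ : ∀ g : (UnitaryGroup.arch (↥(maximalRealSubfield L)) L (IsCMField.complexConj L) 3 (Matrix.of fun i j : Fin 3 => if i.val + j.val + 1 = 3 then (1 : L) else 0)), ((Φ g : (UnitaryGroup.arch (↥(maximalRealSubfield L)) L (IsCMField.complexConj L) 3 (Matrix.diagonal γ))) : GL (Fin 3) (mixedEmbedding.mixedSpace L)) = T * (g : GL (Fin 3) (mixedEmbedding.mixedSpace L)) * T⁻¹)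
  [∀ γ' : (UnitaryGroup.arch (↥(maximalRealSubfield L)) L (IsCMField.complexConj L) 3 (Matrix.diagonal α)), MeasurableSpace ((UnitaryGroup.arch (↥(maximalRealSubfield L)) L (IsCMField.complexConj L) 3 (Matrix.diagonal α)) ⧸ Subgroup.centralizer ({γ'} : Set (UnitaryGroup.arch (↥(maximalRealSubfield L)) L (IsCMField.complexConj L) 3 (Matrix.diagonal α))))]
  [∀ γ' : (UnitaryGroup.arch (↥(maximalRealSubfield L)) L (IsCMField.complexConj L) 3 (Matrix.diagonal α)), BorelSpace ((UnitaryGroup.arch (↥(maximalRealSubfield L)) L (IsCMField.complexConj L) 3 (Matrix.diagonal α)) ⧸ Subgroup.centralizer ({γ'} : Set (UnitaryGroup.arch (↥(maximalRealSubfield L)) L (IsCMField.complexConj L) 3 (Matrix.diagonal α))))]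
  [∀ γ₀ : (UnitaryGroup.arch (↥(maximalRealSubfield L)) L (IsCMField.complexConj L) 3 (Matrix.of fun i j : Fin 3 => if i.val + j.val + 1 = 3 then (1 : L) else 0)), MeasurableSpace ((UnitaryGroup.arch (↥(maximalRealSubfield L)) L (IsCMField.complexConj L) 3 (Matrix.of fun i j : Fin 3 => if i.val + j.val + 1 = 3 then (1 : L) else 0)) ⧸ Subgroup.centralizer ({γ₀} : Set (UnitaryGroup.arch (↥(maximalRealSubfield L)) L (IsCMField.complexConj L) 3 (Matrix.of fun i j : Fin 3 => if i.val + j.val + 1 = 3 then (1 : L) else 0))))]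
  [∀ γ₀ : (UnitaryGroup.arch (↥(maximalRealSubfield L)) L (IsCMField.complexConj L) 3 (Matrix.of fun i j : Fin 3 => if i.val + j.val + 1 = 3 then (1 : L) else 0)), BorelSpace ((UnitaryGroup.arch (↥(maximalRealSubfield L)) L (IsCMField.complexConj L) 3 (Matrix.of fun i j : Fin 3 => if i.val + j.val + 1 = 3 then (1 : L) else 0)) ⧸ Subgroup.centralizer ({γ₀} : Set (UnitaryGroup.arch (↥(maximalRealSubfield L)) L (IsCMField.complexConj L) 3 (Matrix.of fun i j : Fin 3 => if i.val + j.val + 1 = 3 then (1 : L) else 0))))]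

include hC hC'G hΦ in
/-- **THE CLASS-WEIGHTED TORUS READING**: if (v) delivers the pair `(a′, x ↦ w⟦x⟧·ã x)` for a measurable class weight `w` (e.g. Kottwitz's `E_∞`, ★ `kottwitzSignArchWeight`,
via ★ `archStableOrbitalIntegral_classWeight_mul`), then at every regular torus point
`∑ᶠ c′ ∈ {c′ | t_α(z) ∼st out c′}, ∫_{G′_∞} a′(g·out c′·g⁻¹) dν′ = ∑ᶠ c ∈ {c | Φ⁻¹ t_γ(z) ∼st out c}, w c · ∫_{G_∞} ã(x·out c·x⁻¹) dν` — §2 then §3's pull-out termwise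
(`⟦out c⟧ = c`). [cite: Rogawski1990, §14.2 (14.2.1) p. 232; §4.1 (4.1.2) p. 39] -/
theorem finsum_integral_comp_conj_archDiagTorus_eq_finsum_classWeight_mul_of_isArchInnerTransfer
    (hα : ∀ i, α i ≠ 0) (hhermα : ∀ i, (IsCMField.complexConj L (α i) : L) = α i) (hγ : ∀ i, γ i ≠ 0) (hhermγ : ∀ i, (IsCMField.complexConj L (γ i) : L) = γ i)
    (ν' : Measure (UnitaryGroup.arch (↥(maximalRealSubfield L)) L (IsCMField.complexConj L) 3 (Matrix.diagonal α))) (ν : Measure (UnitaryGroup.arch (↥(maximalRealSubfield L)) L (IsCMField.complexConj L) 3 (Matrix.of fun i j : Fin 3 => if i.val + j.val + 1 = 3 then (1 : L) else 0))) [ν'.IsHaarMeasure] [ν'.IsMulRightInvariant] [ν.IsHaarMeasure] [ν.IsMulRightInvariant]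
    (m' : OrbitalMeasureFamily (UnitaryGroup.arch (↥(maximalRealSubfield L)) L (IsCMField.complexConj L) 3 (Matrix.diagonal α))) (m : OrbitalMeasureFamily (UnitaryGroup.arch (↥(maximalRealSubfield L)) L (IsCMField.complexConj L) 3 (Matrix.of fun i j : Fin 3 => if i.val + j.val + 1 = 3 then (1 : L) else 0)))
    (hW' : m'.IsQuotientOf (fun γ₀ => IsRegularElt (γ₀.val : GL (Fin 3) (mixedEmbedding.mixedSpace L))) ν' t')
    (hW : m.IsQuotientOf (fun γ₀ => IsRegularElt (γ₀.val : GL (Fin 3) (mixedEmbedding.mixedSpace L))) ν t)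
    (a' : (UnitaryGroup.arch (↥(maximalRealSubfield L)) L (IsCMField.complexConj L) 3 (Matrix.diagonal α)) → ℂ) (ha' : Measurable a') (w : ConjClasses (UnitaryGroup.arch (↥(maximalRealSubfield L)) L (IsCMField.complexConj L) 3 (Matrix.of fun i j : Fin 3 => if i.val + j.val + 1 = 3 then (1 : L) else 0)) → ℂ) (hw : Measurable fun x : (UnitaryGroup.arch (↥(maximalRealSubfield L)) L (IsCMField.complexConj L) 3 (Matrix.of fun i j : Fin 3 => if i.val + j.val + 1 = 3 then (1 : L) else 0)) => w (ConjClasses.mk x))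
    (ã : (UnitaryGroup.arch (↥(maximalRealSubfield L)) L (IsCMField.complexConj L) 3 (Matrix.of fun i j : Fin 3 => if i.val + j.val + 1 = 3 then (1 : L) else 0)) → ℂ) (hã : Measurable ã) (hit : IsArchInnerTransfer L (Matrix.diagonal α) m' m a' (fun x => w (ConjClasses.mk x) * ã x))
    (z : {w : InfinitePlace L // IsComplex w} → Fin 3 → Circle) (hz : ∀ w', Function.Injective (z w')) :
    ∑ᶠ c' ∈ {c' : ConjClasses (UnitaryGroup.arch (↥(maximalRealSubfield L)) L (IsCMField.complexConj L) 3 (Matrix.diagonal α)) | IsStablyConj (UnitaryGroup.conjMixed (↥(maximalRealSubfield L)) L (IsCMField.complexConj L)) (UnitaryGroup.archFormOf L 3 (Matrix.diagonal α)) (archDiagTorus L 3 α z) (Quotient.out c')}, ∫ g, a' (g * Quotient.out c' * g⁻¹) ∂ν' =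
      ∑ᶠ c ∈ {c : ConjClasses (UnitaryGroup.arch (↥(maximalRealSubfield L)) L (IsCMField.complexConj L) 3 (Matrix.of fun i j : Fin 3 => if i.val + j.val + 1 = 3 then (1 : L) else 0)) | IsStablyConj (UnitaryGroup.conjMixed (↥(maximalRealSubfield L)) L (IsCMField.complexConj L)) (UnitaryGroup.archFormOf L 3 (Matrix.of fun i j : Fin 3 => if i.val + j.val + 1 = 3 then (1 : L) else 0)) (Φ.symm (archDiagTorus L 3 γ z)) (Quotient.out c)}, w c * ∫ x, ã (x * Quotient.out c * x⁻¹) ∂ν := by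
  rw [finsum_integral_comp_conj_archDiagTorus_eq_of_isArchInnerTransfer L α t' t hd' hd₃ hC hC'G γ T Φ hΦ hα hhermα hγ hhermγ ν' ν m' m hW' hW a'
    (fun x => w (ConjClasses.mk x) * ã x) ha' (hw.mul hã) hit z hz]
  refine finsum_mem_congr rfl fun c _ => ?_
  rw [integral_comp_conj_classWeight_mul ν w ã (Quotient.out c), show ConjClasses.mk (Quotient.out c) = c from Quotient.out_eq c]

end TorusWeighted

end Literature.NumberTheory.Rogawski1990

end
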